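import Summits.BirchSwinnertonDyer.BirchSwinnertonDyer.Theorems.BiquadraticEisensteinDescentHeegnerTwistCouplingInSupplyKrizLiCornerX12
import Summits.BirchSwinnertonDyer.BirchSwinnertonDyer.Theorems.PrintCFramJZeroThreeUnitRegimePrimePairInstances
import Summits.BirchSwinnertonDyer.BirchSwinnertonDyer.Theorems.PrintCFramJZeroThreeUnitRegimeOddAndFortyFourClasses
import Literature.NumberTheory.QuadraticFields.ImaginaryQuadraticClassNumberValues
import HarnessLib

set_option linter.dupNamespace false -- `Summit.BirchSwinnertonDyer.BirchSwinnertonDyer.Theorems.…` (summit = sub, D-0017)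
set_option autoImplicit false

/-!
# Crux `HeegnerTwistCouplingInSupply` (stmt-BirchSwinnertonDyer-21381) — X12₊ ∪ QT27₊ at `q ≡ 11 (mod 12)` through the Kriz–Li door,
# KERNEL INSTANCES: the KL3-regular primes `q ≡ 11 (mod 12)`: `q ∈ {11, 23, 47, 59, 71, 107, 191}`

Route `BiquadraticEisensteinDescent` (cell `pub/bsd-wall`, width seat `bsd-wall-cm-bed-w4` g27; `--supports` 21381, helper). Companion of
`…KrizLiCornerX12.lean` (`exists_cruxConclusion_of_prime_pair_three_mod_four`). For each row ONE certificate prime `r ≡ 23 (mod 24)`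
(`2`, `3` split in `ℚ(√−r)`) with `(−r/q) = +1`, `3 ∤ h(−4qr)`, `h(−r) < q` (this seat's `work/py/x12_rows.py`), the two integer
certificates `3 ∤ S₁ = Σ_{j<4qr} χ₄(j)(j/q)(j/r)·j` and `3 ∥ S₂ = Σ_{j<12q} χ₄(j)(j/q)(j/3)·j` DECIDED in the kernel (`χ₄` by
`ZMod.χ₄_nat_eq_if_mod_four`, Jacobi symbols by Euler's criterion in `ℕ`, the cell `bsd-print-cfram`'s `certOne_chiFortyFour_263`
recipe), and ★ `cruxOnX12Plus_<q>`: the CONCLUSION of crux 21381 at `(W, q)` for every globally minimal `W ≅ y² = x³ + q·m²`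
(`36a1^{(q)} = x³ + q³`: `m = q`; `27a^{(q)}`: `m = 4q`) with bad primes `⊂ {2, 3, q}`, `a₂(W) = 0` if good at `2`, `r_an(W) ≠ 0` —
modulo the three named facts `hKL` (Kriz–Li 2019 Thm. 1.20), `hGZ` (Gross–Zagier), `hHP` (Heegner points). `q = 11` has no prime
certificate with `h(−r) < 11`, so §0 adds the `q ∤ h(−r)` form of the `∃`-conclusion and serves it with `r = 263`, `h = 13` (the cell
`bsd-print-cfram`'s own `χ₄₄` certificates, BY NAME); KL3-IRREGULAR
`q ≡ 11 (12)` below `250` (`3 ∣ h(−12q)`): 83, 131, 179, 251; the regular `q = 167, 239` (certificates `r = 71, 47`, 45–47k terms) are left out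
only for file size.

| `q` | `r` | `h(−r)` | terms of `S₁` (`= −4qr·h(−4qr)`) |
|---|---|---|---|
| 11 | 263 | 13 (`11 ∤ 13`) | 11572 (cell `bsd-print-cfram`) |
| 23 | 263 | 13 | 24196 |
| 47 | 23 | 3 | 4324 |
| 59 | 23 | 3 | 5428 |
| 71 | 23 | 3 | 6532 |
| 107 | 71 | 7 | 30388 |
| 191 | 47 | 5 | 35908 |

HONEST FRAMING: cells of ONE more CM family pair; conditional on three REFEREED named facts; per-curve binders `hW`/`h6`/`h2`/`hS`
displayed; the crux (C⁺ / (S3′)(p) for all `p`), its registered stubs and BSD are NOT proved by any of this. THEOREMS ONLY.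
Supports stmt-BirchSwinnertonDyer-21381.
[cite: KrizLi2019, Thm. 1.20 (pp. 7–8), §1.5 (1)] [cite: Washington1997, Thm. 4.2] [cite: GrossZagier1986, Thm. I.(6.3), V.§1–2]
[cite: Cox2013, §1.C (1.15), §2.A Thm. 2.13; §7.B Thm. 7.7(ii)] [cite: IrelandRosen1990, Prop. 5.1.2 (Euler's criterion)]
-/

noncomputable section

open scoped Classical NumberTheorySymbols

namespace Summit.BirchSwinnertonDyer.BirchSwinnertonDyer.Theorems.KrizLiCornerX12

open _root_.WeierstrassCurve NumberField
open Literature.NumberTheory.EllipticCurves Literature.NumberTheory.EllipticCurves.KrizLi2019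
  Literature.NumberTheory.EllipticCurves.ModularForms Literature.NumberTheory.QuadraticFields
  Literature.NumberTheory.QuadraticFields.Quadratic
  Summit.BirchSwinnertonDyer.Rank1Residual.X12.O11.RouteU
  Summit.BirchSwinnertonDyer.BirchSwinnertonDyer.Theorems.PrintCFram

/-! ## §0 The `∃ K′` conclusion from `q ∤ h(−r)` (instead of `h(−r) < q`), and the row `q = 11` with `r = 263`, `h = 13` -/

/-- ★ **The crux's `∃ K′` at `(W, q)`, `q ≡ 11 (mod 12)`, from a prime-pair certificate with `q ∤ h(−r)`** (the size lever
`h(−r) < q` of `exists_cruxConclusion_of_prime_pair_three_mod_four` replaced by the bare indivisibility the crux asks for — needed at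
`q = 11`, whose smallest prime certificate is `r = 263` with `h(−263) = 13 > 11`).
[cite: KrizLi2019, Thm. 1.20 (pp. 7–8)] [cite: GrossZagier1986, Thm. I.(6.3), V.§1–2] [cite: Cox2013, §2.A Thm. 2.13; §7.B Thm. 7.7(ii)] -/
theorem exists_cruxConclusion_of_prime_pair_three_mod_four_of_not_dvd (hKL : thm120_padicLogHeegner_unit_of_bernoulli)
    (hGZ : ∀ (N : ℕ) [NeZero N] (W : WeierstrassCurve ℚ) (K : Type) [Field K] [NumberField K], gross_zagier N W K)
    (hHP : ∀ (W : WeierstrassCurve ℚ) (K : Type) [Field K] [NumberField K], exists_isHeegnerPoint W K)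
    {q r : ℕ} [hq : Fact q.Prime] [hrp : Fact r.Prime] (hq4 : q % 4 = 3) (h3q : jacobiSym 3 q = 1)
    (hr8 : r % 8 = 7) (hr3 : r ≠ 3) (hs3 : jacobiSym (-(r : ℤ)) 3 = 1) (hsq : jacobiSym (-(r : ℤ)) q = 1)
    (hS₁ : ¬ ((3 : ℤ) ∣ ∑ j ∈ Finset.range (4 * q * r),
      (ZMod.χ₄ (j : ZMod 4) * J((j : ℤ) | q) : ℤ) * jacobiSym (j : ℤ) r * (j : ℤ)))
    (hS₂ : (3 : ℤ) ∣ ∑ j ∈ Finset.range (4 * q * 3),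
      (ZMod.χ₄ (j : ZMod 4) * J((j : ℤ) | q) : ℤ) * jacobiSym (j : ℤ) 3 * (j : ℤ) ^ (0 + 1))
    (hS₂' : ¬ ((3 : ℤ) ^ 2 ∣ ∑ j ∈ Finset.range (4 * q * 3),
      (ZMod.χ₄ (j : ZMod 4) * J((j : ℤ) | q) : ℤ) * jacobiSym (j : ℤ) 3 * (j : ℤ) ^ (0 + 1)))
    {h : ℕ} (hclass : BinQF.classNumber (-(r : ℤ)) = h) (hndvd : ¬ q ∣ h)
    (W : WeierstrassCurve ℚ) [W.IsElliptic] [W.IsGloballyMinimal] [NeZero (W.conductorNorm ℤ)]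
    {m : ℤ} (hm : m ≠ 0) (hW : ∃ C : VariableChange ℚ, C • W = mordellCurve ((q : ℚ) * (m : ℚ) ^ 2))
    (h6 : ∀ ℓ : ℕ, ℓ.Prime → ¬ ((ℓ : ℤ) ^ 6 ∣ (q : ℤ) * m ^ 2))
    (h2 : (haveI : Fact (Nat.Prime 2) := ⟨Nat.prime_two⟩; W.HasGoodReductionAtPrime 2) →
      W.LFunction 2 = 0)
    (hS : ∀ ℓ : ℕ, (hℓ : ℓ.Prime) → ¬ (haveI := Fact.mk hℓ; W.HasGoodReductionAtPrime ℓ) →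
      ℓ = 2 ∨ ℓ = 3 ∨ ℓ = q)
    (hr1 : W.analyticRank ≠ 0) :
    ∃ (K : Type) (_ : Field K) (_ : NumberField K),
      IsImaginaryQuadratic K ∧ 4 < (NumberField.discr K).natAbs ∧
      SatisfiesHeegnerHypothesis (W.conductorNorm ℤ) K ∧
      (W.quadraticTwist (NumberField.discr K : ℚ)).entireLFunction 1 ≠ 0 ∧ ¬ q ∣ NumberField.classNumber K := by
  have hr0 : (-(r : ℤ)) < 0 := by have := hrp.out.pos; omega
  have hr4' : (-(r : ℤ)) % 4 = 1 := by omega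
  have hsf : Squarefree (-(r : ℤ)).natAbs := by
    rw [Int.natAbs_neg, Int.natAbs_natCast]; exact hrp.out.squarefree
  obtain ⟨K, iF, iN, hK, hdK, hhK⟩ := SylvesterCorner.exists_field_of_odd (-(r : ℤ)) h hr0 hr4' hsf hclass
  obtain ⟨hHN, hL, -⟩ := heegner_and_twist_L_one_ne_zero_of_prime_pair_three_mod_four hKL hq4 h3q hr8 hr3 hs3 hsq hS₁ hS₂
    hS₂' W hm hW h6 h2 hS hr1 K hK hdK (hGZ _ W K) (hHP W K)
  have hr7 : 4 < r := by have := hrp.out.two_le; omega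
  exact ⟨K, iF, iN, hK, by rw [hdK, Int.natAbs_neg, Int.natAbs_natCast]; exact hr7, hHN, hL, by rw [hhK]; exact hndvd⟩

/-- ★ **The X12₊ corner at `q = 11`** (certificate `r = 263`, `h(−263) = 13`, `11 ∤ 13`; the Heegner field `ℚ(√−263)` and BOTH
certificates are the cell `bsd-print-cfram`'s `certOne_chiFortyFour_263` / `certTwo_chiFortyFour`, BY NAME — classes `17424bb/be/bf`
there): for every globally minimal `W ≅ y² = x³ + 11·m²` (`x³ + 11³` is `m = 11`, `27a^{(11)}` is `m = 44`) with bad primes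
`⊂ {2, 3, 11}`, `a₂(W) = 0` if good at `2`, `r_an(W) ≠ 0`: the CONCLUSION of crux 21381 at `(W, 11)`, modulo `hKL`, `hGZ`, `hHP`.
[cite: KrizLi2019, Thm. 1.20 (pp. 7–8)] [cite: GrossZagier1986, Thm. I.(6.3), V.§1–2] -/
theorem cruxOnX12Plus_11 (hKL : thm120_padicLogHeegner_unit_of_bernoulli)
    (hGZ : ∀ (N : ℕ) [NeZero N] (W : WeierstrassCurve ℚ) (K : Type) [Field K] [NumberField K], gross_zagier N W K)
    (hHP : ∀ (W : WeierstrassCurve ℚ) (K : Type) [Field K] [NumberField K], exists_isHeegnerPoint W K)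
    (W : WeierstrassCurve ℚ) [W.IsElliptic] [W.IsGloballyMinimal] [NeZero (W.conductorNorm ℤ)]
    {m : ℤ} (hm : m ≠ 0) (hW : ∃ C : VariableChange ℚ, C • W = mordellCurve ((11 : ℚ) * (m : ℚ) ^ 2))
    (h6 : ∀ ℓ : ℕ, ℓ.Prime → ¬ ((ℓ : ℤ) ^ 6 ∣ (11 : ℤ) * m ^ 2))
    (h2 : (haveI : Fact (Nat.Prime 2) := ⟨Nat.prime_two⟩; W.HasGoodReductionAtPrime 2) → W.LFunction 2 = 0)
    (hS : ∀ ℓ : ℕ, (hℓ : ℓ.Prime) → ¬ (haveI := Fact.mk hℓ; W.HasGoodReductionAtPrime ℓ) → ℓ = 2 ∨ ℓ = 3 ∨ ℓ = 11)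
    (hr1 : W.analyticRank ≠ 0) :
    ∃ (K : Type) (_ : Field K) (_ : NumberField K),
      IsImaginaryQuadratic K ∧ 4 < (NumberField.discr K).natAbs ∧
      SatisfiesHeegnerHypothesis (W.conductorNorm ℤ) K ∧
      (W.quadraticTwist (NumberField.discr K : ℚ)).entireLFunction 1 ≠ 0 ∧ ¬ 11 ∣ NumberField.classNumber K := by
  haveI : Fact (Nat.Prime 11) := ⟨by norm_num⟩
  haveI : Fact (Nat.Prime 263) := ⟨by norm_num⟩
  exact exists_cruxConclusion_of_prime_pair_three_mod_four_of_not_dvd hKL hGZ hHP (q := 11) (r := 263) (by norm_num)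
    (by norm_num) (by norm_num) (by norm_num) (by norm_num) (by norm_num) certOne_chiFortyFour_263 certTwo_chiFortyFour.1
    certTwo_chiFortyFour.2 ClassNumberValues.classNumber_neg263 (by norm_num) W hm (by exact_mod_cast hW) (by exact_mod_cast h6)
    h2 hS hr1

/-! ## `(q, r) = (23, 263)` -/

set_option maxRecDepth 800000 in
/-- **CERTIFICATES for `(q, r) = (23, 263)`**: `3 ∤ S₁` (24196 terms), `3 ∣ S₂`, `9 ∤ S₂` (`decide +kernel`).
[cite: KrizLi2019, Thm. 1.20 (p. 8) and §1.5 (1)] [cite: Washington1997, Thm. 4.2] -/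
theorem cert_23_263 :
    ¬ ((3 : ℤ) ∣ ∑ j ∈ Finset.range (4 * 23 * 263),
      (ZMod.χ₄ (j : ZMod 4) * J((j : ℤ) | 23) : ℤ) * jacobiSym (j : ℤ) 263 * (j : ℤ)) ∧
    ((3 : ℤ) ∣ ∑ j ∈ Finset.range (4 * 23 * 3),
      (ZMod.χ₄ (j : ZMod 4) * J((j : ℤ) | 23) : ℤ) * jacobiSym (j : ℤ) 3 * (j : ℤ) ^ (0 + 1)) ∧
    ¬ ((3 : ℤ) ^ 2 ∣ ∑ j ∈ Finset.range (4 * 23 * 3),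
      (ZMod.χ₄ (j : ZMod 4) * J((j : ℤ) | 23) : ℤ) * jacobiSym (j : ℤ) 3 * (j : ℤ) ^ (0 + 1)) := by
  simp_rw [ZMod.χ₄_nat_eq_if_mod_four, jacobiSym_prime_eq_ite_nat 23 (by norm_num) (by norm_num),
    jacobiSym_prime_eq_ite_nat 263 (by norm_num) (by norm_num), jacobiSym_prime_eq_ite_nat 3 (by norm_num) (by norm_num)]
  refine ⟨?_, ?_, ?_⟩ <;> decide +kernel

/-- ★ **The X12₊/QT27₊ corner at `q = 23`** (certificate `r = 263`, `h(−263) = 13 < 23`): for every globally minimal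
`W ≅ y² = x³ + 23·m²` (`23m²` sixth-power-free; `x³ + 23³` is `m = 23`, `27a^{(23)}` is `m = 92`) with bad primes `⊂ {2, 3, 23}`,
`a₂(W) = 0` if good at `2`, `r_an(W) ≠ 0`: the CONCLUSION of crux 21381 at `(W, 23)`, modulo `hKL`, `hGZ`, `hHP` only.
[cite: KrizLi2019, Thm. 1.20 (pp. 7–8)] [cite: GrossZagier1986, Thm. I.(6.3), V.§1–2] -/
theorem cruxOnX12Plus_23 (hKL : thm120_padicLogHeegner_unit_of_bernoulli)
    (hGZ : ∀ (N : ℕ) [NeZero N] (W : WeierstrassCurve ℚ) (K : Type) [Field K] [NumberField K], gross_zagier N W K)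
    (hHP : ∀ (W : WeierstrassCurve ℚ) (K : Type) [Field K] [NumberField K], exists_isHeegnerPoint W K)
    (W : WeierstrassCurve ℚ) [W.IsElliptic] [W.IsGloballyMinimal] [NeZero (W.conductorNorm ℤ)]
    {m : ℤ} (hm : m ≠ 0) (hW : ∃ C : VariableChange ℚ, C • W = mordellCurve ((23 : ℚ) * (m : ℚ) ^ 2))
    (h6 : ∀ ℓ : ℕ, ℓ.Prime → ¬ ((ℓ : ℤ) ^ 6 ∣ (23 : ℤ) * m ^ 2))
    (h2 : (haveI : Fact (Nat.Prime 2) := ⟨Nat.prime_two⟩; W.HasGoodReductionAtPrime 2) → W.LFunction 2 = 0)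
    (hS : ∀ ℓ : ℕ, (hℓ : ℓ.Prime) → ¬ (haveI := Fact.mk hℓ; W.HasGoodReductionAtPrime ℓ) → ℓ = 2 ∨ ℓ = 3 ∨ ℓ = 23)
    (hr1 : W.analyticRank ≠ 0) :
    ∃ (K : Type) (_ : Field K) (_ : NumberField K),
      IsImaginaryQuadratic K ∧ 4 < (NumberField.discr K).natAbs ∧
      SatisfiesHeegnerHypothesis (W.conductorNorm ℤ) K ∧
      (W.quadraticTwist (NumberField.discr K : ℚ)).entireLFunction 1 ≠ 0 ∧ ¬ 23 ∣ NumberField.classNumber K := by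
  haveI : Fact (Nat.Prime 23) := ⟨by norm_num⟩
  haveI : Fact (Nat.Prime 263) := ⟨by norm_num⟩
  exact exists_cruxConclusion_of_prime_pair_three_mod_four hKL hGZ hHP (q := 23) (r := 263) (by norm_num) (by norm_num)
    (by norm_num) (by norm_num) (by norm_num) (by norm_num) cert_23_263.1 cert_23_263.2.1 cert_23_263.2.2
    ClassNumberValues.classNumber_neg263 (by norm_num) W hm (by exact_mod_cast hW) (by exact_mod_cast h6) h2 hS hr1

/-! ## `(q, r) = (47, 23)` -/

set_option maxRecDepth 800000 in
/-- **CERTIFICATES for `(q, r) = (47, 23)`**: `3 ∤ S₁` (4324 terms), `3 ∣ S₂`, `9 ∤ S₂` (`decide +kernel`).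
[cite: KrizLi2019, Thm. 1.20 (p. 8) and §1.5 (1)] [cite: Washington1997, Thm. 4.2] -/
theorem cert_47_23 :
    ¬ ((3 : ℤ) ∣ ∑ j ∈ Finset.range (4 * 47 * 23),
      (ZMod.χ₄ (j : ZMod 4) * J((j : ℤ) | 47) : ℤ) * jacobiSym (j : ℤ) 23 * (j : ℤ)) ∧
    ((3 : ℤ) ∣ ∑ j ∈ Finset.range (4 * 47 * 3),
      (ZMod.χ₄ (j : ZMod 4) * J((j : ℤ) | 47) : ℤ) * jacobiSym (j : ℤ) 3 * (j : ℤ) ^ (0 + 1)) ∧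
    ¬ ((3 : ℤ) ^ 2 ∣ ∑ j ∈ Finset.range (4 * 47 * 3),
      (ZMod.χ₄ (j : ZMod 4) * J((j : ℤ) | 47) : ℤ) * jacobiSym (j : ℤ) 3 * (j : ℤ) ^ (0 + 1)) := by
  simp_rw [ZMod.χ₄_nat_eq_if_mod_four, jacobiSym_prime_eq_ite_nat 47 (by norm_num) (by norm_num),
    jacobiSym_prime_eq_ite_nat 23 (by norm_num) (by norm_num), jacobiSym_prime_eq_ite_nat 3 (by norm_num) (by norm_num)]
  refine ⟨?_, ?_, ?_⟩ <;> decide +kernel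

/-- ★ **The X12₊/QT27₊ corner at `q = 47`** (certificate `r = 23`, `h(−23) = 3 < 47`): for every globally minimal
`W ≅ y² = x³ + 47·m²` (`47m²` sixth-power-free; `x³ + 47³` is `m = 47`, `27a^{(47)}` is `m = 188`) with bad primes `⊂ {2, 3, 47}`,
`a₂(W) = 0` if good at `2`, `r_an(W) ≠ 0`: the CONCLUSION of crux 21381 at `(W, 47)`, modulo `hKL`, `hGZ`, `hHP` only.
[cite: KrizLi2019, Thm. 1.20 (pp. 7–8)] [cite: GrossZagier1986, Thm. I.(6.3), V.§1–2] -/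
theorem cruxOnX12Plus_47 (hKL : thm120_padicLogHeegner_unit_of_bernoulli)
    (hGZ : ∀ (N : ℕ) [NeZero N] (W : WeierstrassCurve ℚ) (K : Type) [Field K] [NumberField K], gross_zagier N W K)
    (hHP : ∀ (W : WeierstrassCurve ℚ) (K : Type) [Field K] [NumberField K], exists_isHeegnerPoint W K)
    (W : WeierstrassCurve ℚ) [W.IsElliptic] [W.IsGloballyMinimal] [NeZero (W.conductorNorm ℤ)]
    {m : ℤ} (hm : m ≠ 0) (hW : ∃ C : VariableChange ℚ, C • W = mordellCurve ((47 : ℚ) * (m : ℚ) ^ 2))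
    (h6 : ∀ ℓ : ℕ, ℓ.Prime → ¬ ((ℓ : ℤ) ^ 6 ∣ (47 : ℤ) * m ^ 2))
    (h2 : (haveI : Fact (Nat.Prime 2) := ⟨Nat.prime_two⟩; W.HasGoodReductionAtPrime 2) → W.LFunction 2 = 0)
    (hS : ∀ ℓ : ℕ, (hℓ : ℓ.Prime) → ¬ (haveI := Fact.mk hℓ; W.HasGoodReductionAtPrime ℓ) → ℓ = 2 ∨ ℓ = 3 ∨ ℓ = 47)
    (hr1 : W.analyticRank ≠ 0) :
    ∃ (K : Type) (_ : Field K) (_ : NumberField K),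
      IsImaginaryQuadratic K ∧ 4 < (NumberField.discr K).natAbs ∧
      SatisfiesHeegnerHypothesis (W.conductorNorm ℤ) K ∧
      (W.quadraticTwist (NumberField.discr K : ℚ)).entireLFunction 1 ≠ 0 ∧ ¬ 47 ∣ NumberField.classNumber K := by
  haveI : Fact (Nat.Prime 47) := ⟨by norm_num⟩
  haveI : Fact (Nat.Prime 23) := ⟨by norm_num⟩
  exact exists_cruxConclusion_of_prime_pair_three_mod_four hKL hGZ hHP (q := 47) (r := 23) (by norm_num) (by norm_num)
    (by norm_num) (by norm_num) (by norm_num) (by norm_num) cert_47_23.1 cert_47_23.2.1 cert_47_23.2.2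
    ClassNumberValues.classNumber_neg23 (by norm_num) W hm (by exact_mod_cast hW) (by exact_mod_cast h6) h2 hS hr1

/-! ## `(q, r) = (59, 23)` -/

set_option maxRecDepth 800000 in
/-- **CERTIFICATES for `(q, r) = (59, 23)`**: `3 ∤ S₁` (5428 terms), `3 ∣ S₂`, `9 ∤ S₂` (`decide +kernel`).
[cite: KrizLi2019, Thm. 1.20 (p. 8) and §1.5 (1)] [cite: Washington1997, Thm. 4.2] -/
theorem cert_59_23 :
    ¬ ((3 : ℤ) ∣ ∑ j ∈ Finset.range (4 * 59 * 23),
      (ZMod.χ₄ (j : ZMod 4) * J((j : ℤ) | 59) : ℤ) * jacobiSym (j : ℤ) 23 * (j : ℤ)) ∧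
    ((3 : ℤ) ∣ ∑ j ∈ Finset.range (4 * 59 * 3),
      (ZMod.χ₄ (j : ZMod 4) * J((j : ℤ) | 59) : ℤ) * jacobiSym (j : ℤ) 3 * (j : ℤ) ^ (0 + 1)) ∧
    ¬ ((3 : ℤ) ^ 2 ∣ ∑ j ∈ Finset.range (4 * 59 * 3),
      (ZMod.χ₄ (j : ZMod 4) * J((j : ℤ) | 59) : ℤ) * jacobiSym (j : ℤ) 3 * (j : ℤ) ^ (0 + 1)) := by
  simp_rw [ZMod.χ₄_nat_eq_if_mod_four, jacobiSym_prime_eq_ite_nat 59 (by norm_num) (by norm_num),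
    jacobiSym_prime_eq_ite_nat 23 (by norm_num) (by norm_num), jacobiSym_prime_eq_ite_nat 3 (by norm_num) (by norm_num)]
  refine ⟨?_, ?_, ?_⟩ <;> decide +kernel

/-- ★ **The X12₊/QT27₊ corner at `q = 59`** (certificate `r = 23`, `h(−23) = 3 < 59`): for every globally minimal
`W ≅ y² = x³ + 59·m²` (`59m²` sixth-power-free; `x³ + 59³` is `m = 59`, `27a^{(59)}` is `m = 236`) with bad primes `⊂ {2, 3, 59}`,
`a₂(W) = 0` if good at `2`, `r_an(W) ≠ 0`: the CONCLUSION of crux 21381 at `(W, 59)`, modulo `hKL`, `hGZ`, `hHP` only.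
[cite: KrizLi2019, Thm. 1.20 (pp. 7–8)] [cite: GrossZagier1986, Thm. I.(6.3), V.§1–2] -/
theorem cruxOnX12Plus_59 (hKL : thm120_padicLogHeegner_unit_of_bernoulli)
    (hGZ : ∀ (N : ℕ) [NeZero N] (W : WeierstrassCurve ℚ) (K : Type) [Field K] [NumberField K], gross_zagier N W K)
    (hHP : ∀ (W : WeierstrassCurve ℚ) (K : Type) [Field K] [NumberField K], exists_isHeegnerPoint W K)
    (W : WeierstrassCurve ℚ) [W.IsElliptic] [W.IsGloballyMinimal] [NeZero (W.conductorNorm ℤ)]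
    {m : ℤ} (hm : m ≠ 0) (hW : ∃ C : VariableChange ℚ, C • W = mordellCurve ((59 : ℚ) * (m : ℚ) ^ 2))
    (h6 : ∀ ℓ : ℕ, ℓ.Prime → ¬ ((ℓ : ℤ) ^ 6 ∣ (59 : ℤ) * m ^ 2))
    (h2 : (haveI : Fact (Nat.Prime 2) := ⟨Nat.prime_two⟩; W.HasGoodReductionAtPrime 2) → W.LFunction 2 = 0)
    (hS : ∀ ℓ : ℕ, (hℓ : ℓ.Prime) → ¬ (haveI := Fact.mk hℓ; W.HasGoodReductionAtPrime ℓ) → ℓ = 2 ∨ ℓ = 3 ∨ ℓ = 59)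
    (hr1 : W.analyticRank ≠ 0) :
    ∃ (K : Type) (_ : Field K) (_ : NumberField K),
      IsImaginaryQuadratic K ∧ 4 < (NumberField.discr K).natAbs ∧
      SatisfiesHeegnerHypothesis (W.conductorNorm ℤ) K ∧
      (W.quadraticTwist (NumberField.discr K : ℚ)).entireLFunction 1 ≠ 0 ∧ ¬ 59 ∣ NumberField.classNumber K := by
  haveI : Fact (Nat.Prime 59) := ⟨by norm_num⟩
  haveI : Fact (Nat.Prime 23) := ⟨by norm_num⟩
  exact exists_cruxConclusion_of_prime_pair_three_mod_four hKL hGZ hHP (q := 59) (r := 23) (by norm_num) (by norm_num)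
    (by norm_num) (by norm_num) (by norm_num) (by norm_num) cert_59_23.1 cert_59_23.2.1 cert_59_23.2.2
    ClassNumberValues.classNumber_neg23 (by norm_num) W hm (by exact_mod_cast hW) (by exact_mod_cast h6) h2 hS hr1

/-! ## `(q, r) = (71, 23)` -/

set_option maxRecDepth 800000 in
/-- **CERTIFICATES for `(q, r) = (71, 23)`**: `3 ∤ S₁` (6532 terms), `3 ∣ S₂`, `9 ∤ S₂` (`decide +kernel`).
[cite: KrizLi2019, Thm. 1.20 (p. 8) and §1.5 (1)] [cite: Washington1997, Thm. 4.2] -/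
theorem cert_71_23 :
    ¬ ((3 : ℤ) ∣ ∑ j ∈ Finset.range (4 * 71 * 23),
      (ZMod.χ₄ (j : ZMod 4) * J((j : ℤ) | 71) : ℤ) * jacobiSym (j : ℤ) 23 * (j : ℤ)) ∧
    ((3 : ℤ) ∣ ∑ j ∈ Finset.range (4 * 71 * 3),
      (ZMod.χ₄ (j : ZMod 4) * J((j : ℤ) | 71) : ℤ) * jacobiSym (j : ℤ) 3 * (j : ℤ) ^ (0 + 1)) ∧
    ¬ ((3 : ℤ) ^ 2 ∣ ∑ j ∈ Finset.range (4 * 71 * 3),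
      (ZMod.χ₄ (j : ZMod 4) * J((j : ℤ) | 71) : ℤ) * jacobiSym (j : ℤ) 3 * (j : ℤ) ^ (0 + 1)) := by
  simp_rw [ZMod.χ₄_nat_eq_if_mod_four, jacobiSym_prime_eq_ite_nat 71 (by norm_num) (by norm_num),
    jacobiSym_prime_eq_ite_nat 23 (by norm_num) (by norm_num), jacobiSym_prime_eq_ite_nat 3 (by norm_num) (by norm_num)]
  refine ⟨?_, ?_, ?_⟩ <;> decide +kernel

/-- ★ **The X12₊/QT27₊ corner at `q = 71`** (certificate `r = 23`, `h(−23) = 3 < 71`): for every globally minimal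
`W ≅ y² = x³ + 71·m²` (`71m²` sixth-power-free; `x³ + 71³` is `m = 71`, `27a^{(71)}` is `m = 284`) with bad primes `⊂ {2, 3, 71}`,
`a₂(W) = 0` if good at `2`, `r_an(W) ≠ 0`: the CONCLUSION of crux 21381 at `(W, 71)`, modulo `hKL`, `hGZ`, `hHP` only.
[cite: KrizLi2019, Thm. 1.20 (pp. 7–8)] [cite: GrossZagier1986, Thm. I.(6.3), V.§1–2] -/
theorem cruxOnX12Plus_71 (hKL : thm120_padicLogHeegner_unit_of_bernoulli)
    (hGZ : ∀ (N : ℕ) [NeZero N] (W : WeierstrassCurve ℚ) (K : Type) [Field K] [NumberField K], gross_zagier N W K)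
    (hHP : ∀ (W : WeierstrassCurve ℚ) (K : Type) [Field K] [NumberField K], exists_isHeegnerPoint W K)
    (W : WeierstrassCurve ℚ) [W.IsElliptic] [W.IsGloballyMinimal] [NeZero (W.conductorNorm ℤ)]
    {m : ℤ} (hm : m ≠ 0) (hW : ∃ C : VariableChange ℚ, C • W = mordellCurve ((71 : ℚ) * (m : ℚ) ^ 2))
    (h6 : ∀ ℓ : ℕ, ℓ.Prime → ¬ ((ℓ : ℤ) ^ 6 ∣ (71 : ℤ) * m ^ 2))
    (h2 : (haveI : Fact (Nat.Prime 2) := ⟨Nat.prime_two⟩; W.HasGoodReductionAtPrime 2) → W.LFunction 2 = 0)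
    (hS : ∀ ℓ : ℕ, (hℓ : ℓ.Prime) → ¬ (haveI := Fact.mk hℓ; W.HasGoodReductionAtPrime ℓ) → ℓ = 2 ∨ ℓ = 3 ∨ ℓ = 71)
    (hr1 : W.analyticRank ≠ 0) :
    ∃ (K : Type) (_ : Field K) (_ : NumberField K),
      IsImaginaryQuadratic K ∧ 4 < (NumberField.discr K).natAbs ∧
      SatisfiesHeegnerHypothesis (W.conductorNorm ℤ) K ∧
      (W.quadraticTwist (NumberField.discr K : ℚ)).entireLFunction 1 ≠ 0 ∧ ¬ 71 ∣ NumberField.classNumber K := by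
  haveI : Fact (Nat.Prime 71) := ⟨by norm_num⟩
  haveI : Fact (Nat.Prime 23) := ⟨by norm_num⟩
  exact exists_cruxConclusion_of_prime_pair_three_mod_four hKL hGZ hHP (q := 71) (r := 23) (by norm_num) (by norm_num)
    (by norm_num) (by norm_num) (by norm_num) (by norm_num) cert_71_23.1 cert_71_23.2.1 cert_71_23.2.2
    ClassNumberValues.classNumber_neg23 (by norm_num) W hm (by exact_mod_cast hW) (by exact_mod_cast h6) h2 hS hr1

/-! ## `(q, r) = (107, 71)` -/

set_option maxRecDepth 800000 in
/-- **CERTIFICATES for `(q, r) = (107, 71)`**: `3 ∤ S₁` (30388 terms), `3 ∣ S₂`, `9 ∤ S₂` (`decide +kernel`).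
[cite: KrizLi2019, Thm. 1.20 (p. 8) and §1.5 (1)] [cite: Washington1997, Thm. 4.2] -/
theorem cert_107_71 :
    ¬ ((3 : ℤ) ∣ ∑ j ∈ Finset.range (4 * 107 * 71),
      (ZMod.χ₄ (j : ZMod 4) * J((j : ℤ) | 107) : ℤ) * jacobiSym (j : ℤ) 71 * (j : ℤ)) ∧
    ((3 : ℤ) ∣ ∑ j ∈ Finset.range (4 * 107 * 3),
      (ZMod.χ₄ (j : ZMod 4) * J((j : ℤ) | 107) : ℤ) * jacobiSym (j : ℤ) 3 * (j : ℤ) ^ (0 + 1)) ∧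
    ¬ ((3 : ℤ) ^ 2 ∣ ∑ j ∈ Finset.range (4 * 107 * 3),
      (ZMod.χ₄ (j : ZMod 4) * J((j : ℤ) | 107) : ℤ) * jacobiSym (j : ℤ) 3 * (j : ℤ) ^ (0 + 1)) := by
  simp_rw [ZMod.χ₄_nat_eq_if_mod_four, jacobiSym_prime_eq_ite_nat 107 (by norm_num) (by norm_num),
    jacobiSym_prime_eq_ite_nat 71 (by norm_num) (by norm_num), jacobiSym_prime_eq_ite_nat 3 (by norm_num) (by norm_num)]
  refine ⟨?_, ?_, ?_⟩ <;> decide +kernel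

/-- ★ **The X12₊/QT27₊ corner at `q = 107`** (certificate `r = 71`, `h(−71) = 7 < 107`): for every globally minimal
`W ≅ y² = x³ + 107·m²` (`107m²` sixth-power-free; `x³ + 107³` is `m = 107`, `27a^{(107)}` is `m = 428`) with bad primes `⊂ {2, 3, 107}`,
`a₂(W) = 0` if good at `2`, `r_an(W) ≠ 0`: the CONCLUSION of crux 21381 at `(W, 107)`, modulo `hKL`, `hGZ`, `hHP` only.
[cite: KrizLi2019, Thm. 1.20 (pp. 7–8)] [cite: GrossZagier1986, Thm. I.(6.3), V.§1–2] -/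
theorem cruxOnX12Plus_107 (hKL : thm120_padicLogHeegner_unit_of_bernoulli)
    (hGZ : ∀ (N : ℕ) [NeZero N] (W : WeierstrassCurve ℚ) (K : Type) [Field K] [NumberField K], gross_zagier N W K)
    (hHP : ∀ (W : WeierstrassCurve ℚ) (K : Type) [Field K] [NumberField K], exists_isHeegnerPoint W K)
    (W : WeierstrassCurve ℚ) [W.IsElliptic] [W.IsGloballyMinimal] [NeZero (W.conductorNorm ℤ)]
    {m : ℤ} (hm : m ≠ 0) (hW : ∃ C : VariableChange ℚ, C • W = mordellCurve ((107 : ℚ) * (m : ℚ) ^ 2))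
    (h6 : ∀ ℓ : ℕ, ℓ.Prime → ¬ ((ℓ : ℤ) ^ 6 ∣ (107 : ℤ) * m ^ 2))
    (h2 : (haveI : Fact (Nat.Prime 2) := ⟨Nat.prime_two⟩; W.HasGoodReductionAtPrime 2) → W.LFunction 2 = 0)
    (hS : ∀ ℓ : ℕ, (hℓ : ℓ.Prime) → ¬ (haveI := Fact.mk hℓ; W.HasGoodReductionAtPrime ℓ) → ℓ = 2 ∨ ℓ = 3 ∨ ℓ = 107)
    (hr1 : W.analyticRank ≠ 0) :
    ∃ (K : Type) (_ : Field K) (_ : NumberField K),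
      IsImaginaryQuadratic K ∧ 4 < (NumberField.discr K).natAbs ∧
      SatisfiesHeegnerHypothesis (W.conductorNorm ℤ) K ∧
      (W.quadraticTwist (NumberField.discr K : ℚ)).entireLFunction 1 ≠ 0 ∧ ¬ 107 ∣ NumberField.classNumber K := by
  haveI : Fact (Nat.Prime 107) := ⟨by norm_num⟩
  haveI : Fact (Nat.Prime 71) := ⟨by norm_num⟩
  exact exists_cruxConclusion_of_prime_pair_three_mod_four hKL hGZ hHP (q := 107) (r := 71) (by norm_num) (by norm_num)
    (by norm_num) (by norm_num) (by norm_num) (by norm_num) cert_107_71.1 cert_107_71.2.1 cert_107_71.2.2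
    ClassNumberValues.classNumber_neg71 (by norm_num) W hm (by exact_mod_cast hW) (by exact_mod_cast h6) h2 hS hr1

/-! ## `(q, r) = (191, 47)` -/

set_option maxRecDepth 800000 in
/-- **CERTIFICATES for `(q, r) = (191, 47)`**: `3 ∤ S₁` (35908 terms), `3 ∣ S₂`, `9 ∤ S₂` (`decide +kernel`).
[cite: KrizLi2019, Thm. 1.20 (p. 8) and §1.5 (1)] [cite: Washington1997, Thm. 4.2] -/
theorem cert_191_47 :
    ¬ ((3 : ℤ) ∣ ∑ j ∈ Finset.range (4 * 191 * 47),
      (ZMod.χ₄ (j : ZMod 4) * J((j : ℤ) | 191) : ℤ) * jacobiSym (j : ℤ) 47 * (j : ℤ)) ∧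
    ((3 : ℤ) ∣ ∑ j ∈ Finset.range (4 * 191 * 3),
      (ZMod.χ₄ (j : ZMod 4) * J((j : ℤ) | 191) : ℤ) * jacobiSym (j : ℤ) 3 * (j : ℤ) ^ (0 + 1)) ∧
    ¬ ((3 : ℤ) ^ 2 ∣ ∑ j ∈ Finset.range (4 * 191 * 3),
      (ZMod.χ₄ (j : ZMod 4) * J((j : ℤ) | 191) : ℤ) * jacobiSym (j : ℤ) 3 * (j : ℤ) ^ (0 + 1)) := by
  simp_rw [ZMod.χ₄_nat_eq_if_mod_four, jacobiSym_prime_eq_ite_nat 191 (by norm_num) (by norm_num),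
    jacobiSym_prime_eq_ite_nat 47 (by norm_num) (by norm_num), jacobiSym_prime_eq_ite_nat 3 (by norm_num) (by norm_num)]
  refine ⟨?_, ?_, ?_⟩ <;> decide +kernel

/-- ★ **The X12₊/QT27₊ corner at `q = 191`** (certificate `r = 47`, `h(−47) = 5 < 191`): for every globally minimal
`W ≅ y² = x³ + 191·m²` (`191m²` sixth-power-free; `x³ + 191³` is `m = 191`, `27a^{(191)}` is `m = 764`) with bad primes `⊂ {2, 3, 191}`,
`a₂(W) = 0` if good at `2`, `r_an(W) ≠ 0`: the CONCLUSION of crux 21381 at `(W, 191)`, modulo `hKL`, `hGZ`, `hHP` only.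
[cite: KrizLi2019, Thm. 1.20 (pp. 7–8)] [cite: GrossZagier1986, Thm. I.(6.3), V.§1–2] -/
theorem cruxOnX12Plus_191 (hKL : thm120_padicLogHeegner_unit_of_bernoulli)
    (hGZ : ∀ (N : ℕ) [NeZero N] (W : WeierstrassCurve ℚ) (K : Type) [Field K] [NumberField K], gross_zagier N W K)
    (hHP : ∀ (W : WeierstrassCurve ℚ) (K : Type) [Field K] [NumberField K], exists_isHeegnerPoint W K)
    (W : WeierstrassCurve ℚ) [W.IsElliptic] [W.IsGloballyMinimal] [NeZero (W.conductorNorm ℤ)]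
    {m : ℤ} (hm : m ≠ 0) (hW : ∃ C : VariableChange ℚ, C • W = mordellCurve ((191 : ℚ) * (m : ℚ) ^ 2))
    (h6 : ∀ ℓ : ℕ, ℓ.Prime → ¬ ((ℓ : ℤ) ^ 6 ∣ (191 : ℤ) * m ^ 2))
    (h2 : (haveI : Fact (Nat.Prime 2) := ⟨Nat.prime_two⟩; W.HasGoodReductionAtPrime 2) → W.LFunction 2 = 0)
    (hS : ∀ ℓ : ℕ, (hℓ : ℓ.Prime) → ¬ (haveI := Fact.mk hℓ; W.HasGoodReductionAtPrime ℓ) → ℓ = 2 ∨ ℓ = 3 ∨ ℓ = 191)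
    (hr1 : W.analyticRank ≠ 0) :
    ∃ (K : Type) (_ : Field K) (_ : NumberField K),
      IsImaginaryQuadratic K ∧ 4 < (NumberField.discr K).natAbs ∧
      SatisfiesHeegnerHypothesis (W.conductorNorm ℤ) K ∧
      (W.quadraticTwist (NumberField.discr K : ℚ)).entireLFunction 1 ≠ 0 ∧ ¬ 191 ∣ NumberField.classNumber K := by
  haveI : Fact (Nat.Prime 191) := ⟨by norm_num⟩
  haveI : Fact (Nat.Prime 47) := ⟨by norm_num⟩
  exact exists_cruxConclusion_of_prime_pair_three_mod_four hKL hGZ hHP (q := 191) (r := 47) (by norm_num) (by norm_num)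
    (by norm_num) (by norm_num) (by norm_num) (by norm_num) cert_191_47.1 cert_191_47.2.1 cert_191_47.2.2
    ClassNumberValues.classNumber_neg47 (by norm_num) W hm (by exact_mod_cast hW) (by exact_mod_cast h6) h2 hS hr1

end Summit.BirchSwinnertonDyer.BirchSwinnertonDyer.Theorems.KrizLiCornerX12

end
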